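import Summits.Ventures.HodgeRepro2.T5CyclotomicStaysPrimeIffEven
import Summits.Ventures.HodgeRepro2.T5RecordSatakeSevenCensus

/-!
# FOR EVERY ODD PRIME `ℓ`: the record's spherical Hecke algebra on `ℚ(ζ_ℓ)` is commutative at every place of
# `ℚ(ζ_ℓ)⁺` prime to `ℓ`, and is `k[T₁]` with `q = p^{o/2}` at the places above a prime of even order `o`

Tier-5 support N3 / §G-N4.2 (seat p3, gen 79). Files 268 / 271 are the statements for the field of record `ℚ(ζ₇)`.
With file 272's general criterion (a place `v` of `ℚ(ζ_ℓ)⁺` above `p ≠ ℓ` stays prime in `ℚ(ζ_ℓ)` iff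
`o := orderOf (p mod ℓ)` is even) the same two branches give the statements for EVERY odd prime `ℓ`, with the residue
cardinality explicit: `f(v/p) · f(w/v) = o` (the tower law, Mathlib's `inertiaDeg_eq_of_not_dvd`) and `f(w/v) = 2` or
`1` according to the branch, so `N(v) = p^{o/2}` (even `o`) or `p^o` (odd `o`):

* `inertiaDeg_over_eq_two_of_even`, `inertiaDeg_over_eq_one_of_odd`, `inertiaDeg_mul_eq_orderOf`,
  **`absNorm_eq_pow_of_even`**, **`absNorm_eq_pow_of_odd`** — the local data;
* **`heckeAlgebra_mul_comm_record_cyclotomic`**, **`heckeAlgebra_mul_comm_record_cyclotomic_of_notMem`** —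
  `H(U(1 ⊗ H₀), K_v)` is commutative at every place `v` of `ℚ(ζ_ℓ)⁺` above `p ≠ ℓ` (resp. with `ℓ ∉ v`);
* **`nonempty_algEquiv_polynomial_record_cyclotomic_of_even`**,
  **`exists_doubleCosetOp_aeval_bijective_and_ncard_record_cyclotomic_of_even`** — `k[X]` with
  `deg T₁ = p^{2o} + p^{o/2} = q⁴ + q` at every place above a prime of even order.

§8(d): uses an L-value-free non-vanishing device: NO.
-/

open Matrix NumberField NumberField.IsCMField IsDedekindDomain IsDedekindDomain.HeightOneSpectrum Module Polynomial
  MulAction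
open scoped TensorProduct Pointwise
open Summit.Ventures.HodgeRepro2.T5UnitaryGroupForm Summit.Ventures.HodgeRepro2.T5UnitaryHeckeAdjoint
  Summit.Ventures.HodgeRepro2.T5HeckePermutationModule Summit.Ventures.HodgeRepro2.T5HeckeDoubleCoset
  Summit.Ventures.HodgeRepro2.T5RecordHyperspecial Summit.Ventures.HodgeRepro2.T5GlobalLatticeAlmostAll
  Summit.Ventures.HodgeRepro2.T5FinitePlaceSplitClassification Summit.Ventures.HodgeRepro2.T5RecordSatakeIntrinsic
  Summit.Ventures.HodgeRepro2.T5CMFieldSquareDatum Summit.Ventures.HodgeRepro2.T5RecordSatakeToy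
  Summit.Ventures.HodgeRepro2.T5RecordSatakeSplitToy Summit.Ventures.HodgeRepro2.T5RecordSatakeDegreeIntrinsic
  Summit.Ventures.HodgeRepro2.T5SplitPlaceUnitaryGroup Summit.Ventures.HodgeRepro2.T5NonSplitPlaceUnitaryGroup
  Summit.Ventures.HodgeRepro2.T5FinitePlaceCM Summit.Ventures.HodgeRepro2.T5StarOfInvolution
  Summit.Ventures.HodgeRepro2.T5RecordSatake Summit.Ventures.HodgeRepro2.T5RecordSatakeInert
  Summit.Ventures.HodgeRepro2.T5RecordSatakeCell Summit.Ventures.HodgeRepro2.T5RecordSatakeDegree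
  Summit.Ventures.HodgeRepro2.T5FinitePlaceSplitIff Summit.Ventures.HodgeRepro2.T5FinitePlaceLocalDegree
  Summit.Ventures.HodgeRepro2.T5CyclotomicSevenInertPrime Summit.Ventures.HodgeRepro2.T5CyclotomicSevenHeckeCommutative
  Summit.Ventures.HodgeRepro2.T5CyclotomicStaysPrimeIffEven

namespace Summit.Ventures.HodgeRepro2.T5CyclotomicHeckeCommutative

section Local

variable (ℓ : ℕ) [hℓ : Fact ℓ.Prime] (h2 : 2 < ℓ)
variable (K : Type*) [Field K] [CharZero K] [IsCyclotomicExtension {ℓ} ℚ K]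
variable (p : ℕ) [hp : Fact p.Prime] (hn : p.Coprime ℓ)
variable (v : HeightOneSpectrum (𝓞 (maximalRealSubfield K))) [hv : v.asIdeal.LiesOver (Ideal.span {(p : ℤ)})]
variable (w : HeightOneSpectrum (𝓞 K)) [hw : w.asIdeal.LiesOver v.asIdeal]
include hv hn hw

include h2 in
/-- **`f(w/v) = 2` when `orderOf (p mod ℓ)` is even** (one prime above `v`, `e(w/v) = 1`, the fundamental identity
`#{w ∣ v} · e · f = 2`). -/
theorem inertiaDeg_over_eq_two_of_even (heven : Even (orderOf (p : ZMod ℓ))) :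
    haveI := numberFieldCyc ℓ K; haveI := isCMFieldCyc ℓ h2 K
    w.asIdeal.inertiaDeg (𝓞 (maximalRealSubfield K)) = 2 := by
  haveI := numberFieldCyc ℓ K
  haveI := isCMFieldCyc ℓ h2 K
  have h := ncard_primesOver_mul_eq_two K v
  rw [Ideal.ramificationIdxIn_eq_ramificationIdx v.asIdeal w.asIdeal (K ≃ₐ[maximalRealSubfield K] K),
    Ideal.inertiaDegIn_eq_inertiaDeg v.asIdeal w.asIdeal (K ≃ₐ[maximalRealSubfield K] K),
    T5CyclotomicStaysPrimeIffEven.ramificationIdx_over_eq_one ℓ K p hn v w, one_mul,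
    (ncard_primesOver_eq_one_iff_even ℓ h2 K p hn v).mpr heven, one_mul] at h
  exact h

include h2 in
/-- **`f(w/v) = 1` when `orderOf (p mod ℓ)` is odd** (two primes above `v`). -/
theorem inertiaDeg_over_eq_one_of_odd (hodd : Odd (orderOf (p : ZMod ℓ))) :
    haveI := numberFieldCyc ℓ K; haveI := isCMFieldCyc ℓ h2 K
    w.asIdeal.inertiaDeg (𝓞 (maximalRealSubfield K)) = 1 := by
  haveI := numberFieldCyc ℓ K
  haveI := isCMFieldCyc ℓ h2 K
  have h := ncard_primesOver_mul_eq_two K v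
  rw [Ideal.ramificationIdxIn_eq_ramificationIdx v.asIdeal w.asIdeal (K ≃ₐ[maximalRealSubfield K] K),
    Ideal.inertiaDegIn_eq_inertiaDeg v.asIdeal w.asIdeal (K ≃ₐ[maximalRealSubfield K] K),
    T5CyclotomicStaysPrimeIffEven.ramificationIdx_over_eq_one ℓ K p hn v w, one_mul,
    (ncard_primesOver_eq_two_iff_odd ℓ h2 K p hn v).mpr hodd] at h
  omega

/-- **The tower law `f(v/p) · f(w/v) = f(w/p) = orderOf (p mod ℓ)`** (Mathlib's `inertiaDeg_eq_of_not_dvd`). -/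
theorem inertiaDeg_mul_eq_orderOf :
    haveI := numberFieldCyc ℓ K
    v.asIdeal.inertiaDeg ℤ * w.asIdeal.inertiaDeg (𝓞 (maximalRealSubfield K)) = orderOf (p : ZMod ℓ) := by
  haveI := numberFieldCyc ℓ K
  haveI : w.asIdeal.LiesOver (Ideal.span {(p : ℤ)}) := Ideal.LiesOver.trans w.asIdeal v.asIdeal _
  have htower := Ideal.inertiaDeg_tower (R := ℤ) v.asIdeal w.asIdeal
  rw [IsCyclotomicExtension.Rat.inertiaDeg_eq_of_not_dvd (m := ℓ) p K w.asIdeal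
    ((Nat.Prime.coprime_iff_not_dvd hp.out).mp hn)] at htower
  exact htower.symm

include h2 in
/-- **`N(v) = p^{o/2}` when `o = orderOf (p mod ℓ)` is even.** -/
theorem absNorm_eq_pow_of_even (heven : Even (orderOf (p : ZMod ℓ))) :
    haveI := numberFieldCyc ℓ K; haveI := isCMFieldCyc ℓ h2 K
    Ideal.absNorm v.asIdeal = p ^ (orderOf (p : ZMod ℓ) / 2) := by
  haveI := numberFieldCyc ℓ K
  haveI := isCMFieldCyc ℓ h2 K
  have h := Ideal.absNorm_pow_inertiaDeg (Ideal.span {(p : ℤ)}) v.asIdeal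
  have ho := inertiaDeg_mul_eq_orderOf ℓ K p hn v w
  rw [inertiaDeg_over_eq_two_of_even ℓ h2 K p hn v w heven] at ho
  rw [absNorm_span_natCast_int, show v.asIdeal.inertiaDeg ℤ = orderOf (p : ZMod ℓ) / 2 by omega] at h
  exact h.symm

include h2 in
/-- **`N(v) = p^{o}` when `o = orderOf (p mod ℓ)` is odd.** -/
theorem absNorm_eq_pow_of_odd (hodd : Odd (orderOf (p : ZMod ℓ))) :
    haveI := numberFieldCyc ℓ K; haveI := isCMFieldCyc ℓ h2 K
    Ideal.absNorm v.asIdeal = p ^ orderOf (p : ZMod ℓ) := by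
  haveI := numberFieldCyc ℓ K
  haveI := isCMFieldCyc ℓ h2 K
  have h := Ideal.absNorm_pow_inertiaDeg (Ideal.span {(p : ℤ)}) v.asIdeal
  have ho := inertiaDeg_mul_eq_orderOf ℓ K p hn v w
  rw [inertiaDeg_over_eq_one_of_odd ℓ h2 K p hn v w hodd, mul_one] at ho
  rw [absNorm_span_natCast_int, ho] at h
  exact h.symm

end Local

section Hecke

variable (ℓ : ℕ) [hℓ : Fact ℓ.Prime] (h2 : 2 < ℓ)
variable (K : Type*) [Field K] [CharZero K] [IsCyclotomicExtension {ℓ} ℚ K]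
variable (p : ℕ) [hp : Fact p.Prime] (hn : p.Coprime ℓ)
variable (v : HeightOneSpectrum (𝓞 (maximalRealSubfield K))) [hv : v.asIdeal.LiesOver (Ideal.span {(p : ℤ)})]
include h2 hn hv

/-- **Two distinct places of `ℚ(ζ_ℓ)` above `v` when `orderOf (p mod ℓ)` is odd.** -/
theorem exists_ne_liesOver_of_odd (hodd : Odd (orderOf (p : ZMod ℓ))) :
    haveI := numberFieldCyc ℓ K; haveI := isCMFieldCyc ℓ h2 K
    ∃ w₁ w₂ : HeightOneSpectrum (𝓞 K), w₁ ≠ w₂ ∧ w₁.asIdeal.LiesOver v.asIdeal ∧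
      w₂.asIdeal.LiesOver v.asIdeal := by
  haveI := numberFieldCyc ℓ K
  haveI := isCMFieldCyc ℓ h2 K
  obtain ⟨x, z, hxz, hs⟩ := Set.ncard_eq_two.mp ((ncard_primesOver_eq_two_iff_odd ℓ h2 K p hn v).mpr hodd)
  have hx : x ∈ v.asIdeal.primesOver (𝓞 K) := by rw [hs]; exact Set.mem_insert x _
  have hz : z ∈ v.asIdeal.primesOver (𝓞 K) := by rw [hs]; exact Set.mem_insert_of_mem x rfl
  haveI := hx.1
  haveI := hx.2
  haveI := hz.1
  haveI := hz.2
  refine ⟨⟨x, hx.1, Ideal.ne_bot_of_liesOver_of_ne_bot v.ne_bot x⟩,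
    ⟨z, hz.1, Ideal.ne_bot_of_liesOver_of_ne_bot v.ne_bot z⟩, ?_, hx.2, hz.2⟩
  intro h
  exact hxz (congrArg HeightOneSpectrum.asIdeal h)

/-- **THE RECORD'S SPHERICAL HECKE ALGEBRA ON `ℚ(ζ_ℓ)` IS COMMUTATIVE AT EVERY PLACE OF `ℚ(ζ_ℓ)⁺` ABOVE A PRIME
`p ≠ ℓ`**, for every odd prime `ℓ`, every family `l` of generators and every field `k`: even order — `v` stays prime
and file 236 applies; odd order — two places above `v` and file 250 applies. -/
theorem heckeAlgebra_mul_comm_record_cyclotomic (k : Type*) [Field k] {r : ℕ} (l : Fin r → 𝓞 K)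
    (hl : Submodule.span (𝓞 (maximalRealSubfield K)) (Set.range l) = ⊤)
    (T S : (haveI := numberFieldCyc ℓ K; haveI := isCMFieldCyc ℓ h2 K; letI := tensorStarRing K v;
      ↥(heckeAlgebra k (recordHyperspecial K v l (gramToy K))))) :
    T * S = S * T :=
  haveI := numberFieldCyc ℓ K
  haveI := isCMFieldCyc ℓ h2 K
  (Nat.even_or_odd (orderOf (p : ZMod ℓ))).elim
    (fun h => ((exists_map_eq_iff_even ℓ h2 K p hn v).mpr h).elim fun w hmap =>
      @T5RecordSatakeIntrinsic.heckeAlgebra_mul_comm_record_of_staysPrime K _ (numberFieldCyc ℓ K)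
        (isCMFieldCyc ℓ h2 K) v w (liesOver_of_map_eq K v w hmap) _ l k _ hl hmap _ gramToy_isHermitian
        isUnit_det_gramToy (notMem_badSet_gramToy _) T S)
    (fun h => (exists_ne_liesOver_of_odd ℓ h2 K p hn v h).elim fun w₁ h => h.elim fun w₂ h =>
      @heckeAlgebra_mul_comm_record_of_ne_of_liesOver K _ (numberFieldCyc ℓ K) (isCMFieldCyc ℓ h2 K) v w₁ w₂ _ l k
        _ hl h.1 h.2.1 h.2.2 _ _ _ _ gramToy_isHermitian isUnit_det_gramToy (notMem_badSet_gramToy _) T S)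

/-- **`H(U(1 ⊗ H₀), K_v) ≃ k[X]` at every place above a prime of even order** (file 236). -/
theorem nonempty_algEquiv_polynomial_record_cyclotomic_of_even (heven : Even (orderOf (p : ZMod ℓ)))
    (k : Type*) [Field k] {r : ℕ} (l : Fin r → 𝓞 K)
    (hl : Submodule.span (𝓞 (maximalRealSubfield K)) (Set.range l) = ⊤) :
    haveI := numberFieldCyc ℓ K; haveI := isCMFieldCyc ℓ h2 K
    Nonempty (Polynomial k ≃ₐ[k]
      (letI := tensorStarRing K v; ↥(heckeAlgebra k (recordHyperspecial K v l (gramToy K))))) :=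
  haveI := numberFieldCyc ℓ K
  haveI := isCMFieldCyc ℓ h2 K
  ((exists_map_eq_iff_even ℓ h2 K p hn v).mpr heven).elim fun w hmap =>
    @T5RecordSatakeIntrinsic.nonempty_algEquiv_polynomial_record_of_staysPrime K _ (numberFieldCyc ℓ K)
      (isCMFieldCyc ℓ h2 K) v w (liesOver_of_map_eq K v w hmap) _ l k _ hl hmap _ gramToy_isHermitian
      isUnit_det_gramToy (notMem_badSet_gramToy _)

/-- **`deg T₁ = p^{2o} + p^{o/2} = q⁴ + q` with `q = p^{o/2}` at every place above a prime of even order `o`**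
(file 245's datum-free generator with `(N(v)³ + 1) · N(v)` and `N(v) = p^{o/2}`). -/
theorem exists_doubleCosetOp_aeval_bijective_and_ncard_record_cyclotomic_of_even
    (heven : Even (orderOf (p : ZMod ℓ))) (k : Type*) [Field k] {r : ℕ} (l : Fin r → 𝓞 K)
    (hl : Submodule.span (𝓞 (maximalRealSubfield K)) (Set.range l) = ⊤) :
    haveI := numberFieldCyc ℓ K; haveI := isCMFieldCyc ℓ h2 K
    ∃ g₀ : (letI := tensorStarRing K v; ↥(formUnitaryGroup (tensorGram K v (gramToy K)))),
      (orbit (recordHyperspecial K v l (gramToy K))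
        (g₀ : _ ⧸ recordHyperspecial K v l (gramToy K))).ncard =
          p ^ (4 * (orderOf (p : ZMod ℓ) / 2)) + p ^ (orderOf (p : ZMod ℓ) / 2) ∧
      ∃ _ : Finite (orbit (recordHyperspecial K v l (gramToy K))
          (g₀ : _ ⧸ recordHyperspecial K v l (gramToy K))),
        Function.Bijective (aeval (doubleCosetOp k (recordHyperspecial K v l (gramToy K)) g₀) :
          k[X] →ₐ[k] heckeAlgebra k (recordHyperspecial K v l (gramToy K))) := by
  haveI := numberFieldCyc ℓ K
  haveI := isCMFieldCyc ℓ h2 K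
  refine ((exists_map_eq_iff_even ℓ h2 K p hn v).mpr heven).elim fun w hmap => ?_
  have key := @exists_doubleCosetOp_aeval_bijective_and_ncard_record_of_staysPrime K _ (numberFieldCyc ℓ K)
    (isCMFieldCyc ℓ h2 K) v w (liesOver_of_map_eq K v w hmap) hmap _ l k _ hl _ gramToy_isHermitian
    isUnit_det_gramToy (notMem_badSet_gramToy _)
  obtain ⟨g₀, hn', hb⟩ := key
  exact ⟨g₀, hn'.trans (by
    rw [absNorm_eq_pow_of_even ℓ h2 K p hn v w (hw := liesOver_of_map_eq K v w hmap) heven, ← pow_mul]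
    ring), hb⟩

end Hecke

section Intrinsic

variable (ℓ : ℕ) [hℓ : Fact ℓ.Prime] (h2 : 2 < ℓ)
variable (K : Type*) [Field K] [CharZero K] [IsCyclotomicExtension {ℓ} ℚ K]
variable (v : HeightOneSpectrum (𝓞 (maximalRealSubfield K)))

omit [CharZero K] [IsCyclotomicExtension {ℓ} ℚ K] in
/-- If `v` lies above `p` and `ℓ ∉ v`, then `p` is coprime to `ℓ`. -/
theorem coprime_of_notMem [NumberField K] (p : ℕ) [hp : Fact p.Prime]
    [hv : v.asIdeal.LiesOver (Ideal.span {(p : ℤ)})] (hℓv : ((ℓ : ℕ) : 𝓞 (maximalRealSubfield K)) ∉ v.asIdeal) :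
    p.Coprime ℓ := by
  rw [Nat.Prime.coprime_iff_not_dvd hp.out]
  intro hdvd
  apply hℓv
  have hpℓ : p = ℓ := (Nat.prime_dvd_prime_iff_eq hp.out hℓ.out).mp hdvd
  have hmem : (p : ℤ) ∈ Ideal.span {(p : ℤ)} := Ideal.mem_span_singleton_self (p : ℤ)
  rw [Ideal.mem_of_liesOver v.asIdeal (Ideal.span {(p : ℤ)}) p, map_natCast, hpℓ] at hmem
  exact hmem

include h2 in
/-- **THE INTRINSIC FORM FOR EVERY ODD PRIME `ℓ`: `H(U(1 ⊗ H₀), K_v)` IS COMMUTATIVE AT EVERY PLACE `v` OF `ℚ(ζ_ℓ)⁺`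
WITH `ℓ ∉ v`.** -/
theorem heckeAlgebra_mul_comm_record_cyclotomic_of_notMem (hℓv : ((ℓ : ℕ) : 𝓞 (maximalRealSubfield K)) ∉ v.asIdeal)
    (k : Type*) [Field k] {r : ℕ} (l : Fin r → 𝓞 K)
    (hl : Submodule.span (𝓞 (maximalRealSubfield K)) (Set.range l) = ⊤)
    (T S : (haveI := numberFieldCyc ℓ K; haveI := isCMFieldCyc ℓ h2 K; letI := tensorStarRing K v;
      ↥(heckeAlgebra k (recordHyperspecial K v l (gramToy K))))) :
    T * S = S * T :=
  haveI := numberFieldCyc ℓ K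
  haveI := isCMFieldCyc ℓ h2 K
  (exists_prime_liesOver (maximalRealSubfield K) v).elim fun p h =>
    haveI : Fact p.Prime := ⟨h.1⟩
    haveI := h.2
    heckeAlgebra_mul_comm_record_cyclotomic ℓ h2 K p (coprime_of_notMem ℓ K v p hℓv) v k l hl T S

end Intrinsic

end Summit.Ventures.HodgeRepro2.T5CyclotomicHeckeCommutative
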